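import Summits.ABC.IUTFork.Repair.ObstructionSS44
import HarnessLib

/-!
# IUT REPAIR branch, sub-cell B5 (Scholze–Stix §2.2 typed AS OBSTRUCTION) — THE HONEST SPLITTING MONOID IS STAR-MOVING, II:
# the (Ind1) capsule transposition, for IRRATIONAL theta values (single-place fibres included)

Record file (D-0012) of the abc-iut cell, IUT REPAIR branch (rung LADDER-ABC:A2.RP; lead abc-iut-rp-plan); seat abc-iut-rp-s3 (prover, gen 3);
sequel to `Repair/ObstructionSS44`. PROOF-ONLY (no definition, no `Prop` fact); every hypothesis is a binder; TAKES NO SIDE on [IUTchIII]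
Cor. 3.12 and on no author; typed ≠ proved; instantiated ≠ endorsed.

WHAT. `ObstructionSS44` moved abc-iut-c312-5's honest LGP splitting monoid `Real.splittingMonoidLGP X logv … v qroot ζ` by an (Ind2)-element
when a SECOND place of `F` lies over the prime of `v`. Here the complementary mover: the (Ind1) CAPSULE TRANSPOSITION `(0 j)` at every label
(Dupuy–Hilado §4.7: (Ind1) = the capsule permutations, `Real.mem_Ind1_logShellsDH_iff`; [IUTchIII] Thm. 3.11 (i) (Ind1) p. 154 l. 52–54) carries
the unit embedding `1 ⊗ ⋯ ⊗ 1 ⊗ (x·e_v)` to `(x·e_v) ⊗ 1 ⊗ ⋯ ⊗ 1`, which is a unit embedding only if `x·e_v ∈ ℚ·(1, …, 1)` — impossible as soon as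
the theta value `x = ζ_j·q̳_v^{j²}` is IRRATIONAL in `K_v` (binder `hirr`; in print's situation this holds because the Tate parameter of a curve
with algebraic `j`-invariant is transcendental — the `p`-adic Mahler–Manin theorem of Barré-Sirieix–Diaz–Gramain–Philibert (1996), NOT typed
here) or a second place lies over the prime (then `x·e_v` has a zero coordinate; that case is `ObstructionSS44`'s):
* `tprod_swap_ne_unitEmbed` — the swapped pure tensor is not a unit embedding when `x·e_v ∉ ℚ·(1,…,1)` (separation by a functional killing
  `(1,…,1)`, `Submodule.exists_dual_map_eq_bot_of_notMem`);
* `exists_ind1Family_moves_splittingMonoidLGP_of_irrational` — for `ζ_{j₀}·qroot^{j₀²} ∉ ℚ` at one star label, some `Φ ∈ Ind1Family` of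
  `logShellsDH X logv` moves the monoid; `not_insulated_of_eq_splittingMonoidLGP_of_irrational` — star-moving.
READING (neutral): together with `ObstructionSS44`, the tree's honest Θ-datum is on the STAR-MOVING horn of `ObstructionSS38`'s dichotomy at every
bad place whose theta values are irrational or whose prime splits further; what is then left at level R is the consistency clause at the bad
packets (`ObstructionSS39`/`40`). [cite: ScholzeStix2018, §2.2 pp. 9–10] [claim: Mochizuki2012, status: disputed] [cite: DupuyHilado2025, §4.7]
-/

noncomputable section

open Set

namespace Summit.ABC.IUTFork.Repair.ObstructionSS46

open Thm311 Thm311.Real Cor312 Cor312Vol Literature.IUT.LogThetaLattice Literature.IUT.LogVolume Literature.IUT.HodgeArakelov NumberField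
  IsDedekindDomain

variable {F : Type} [Field F] [NumberField F] (X : PilotData F) (logv : PadicLogs F)

/-! ## 1. The swapped pure tensor `(x·e_v) ⊗ 1 ⊗ ⋯ ⊗ 1` is not a unit embedding when `x·e_v ∉ ℚ·(1,…,1)` -/

open scoped Classical in
/-- **Separation, swapped form.** At a star label `j = i+1`: if the vector `x·e_v` of `⊕_{u | p} K_u` is not a rational multiple of the unit
`(1, …, 1)`, then the pure tensor whose factor `0` is `x·e_v` and whose other factors are `(1, …, 1)` is NOT a unit embedding
`1 ⊗ ⋯ ⊗ 1 ⊗ (y'·e_v)` (a functional vanishing on `(1,…,1)` and not on `x·e_v`, on the factor `0`). [folklore] -/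
theorem tprod_swap_ne_unitEmbed (v : HeightOneSpectrum (𝓞 F)) (i : Fin (thetaIndex X).lstar) (x : Carrier (.inr v : (thetaIndex X).V))
    (hx : (Pi.single (M := fun u : (thetaIndex X).Fibre ((thetaIndex X).over (.inr v : (thetaIndex X).V)) => Carrier u.1)
        ((thetaIndex X).toFibre (.inr v : (thetaIndex X).V)) x :
          (logShellsDH X logv).Packet1 ((thetaIndex X).over (.inr v : (thetaIndex X).V))) ∉
      Submodule.span ℚ {(fun u : (thetaIndex X).Fibre ((thetaIndex X).over (.inr v : (thetaIndex X).V)) => (1 : Carrier u.1) :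
          (logShellsDH X logv).Packet1 ((thetaIndex X).over (.inr v : (thetaIndex X).V)))})
    (y' : Carrier (.inr v : (thetaIndex X).V)) :
    (logShellsDH X logv).tprod (Setting.labelSucc i) _
        (fun a => if a = 0 then
            (Pi.single (M := fun u : (thetaIndex X).Fibre ((thetaIndex X).over (.inr v : (thetaIndex X).V)) => Carrier u.1)
              ((thetaIndex X).toFibre (.inr v : (thetaIndex X).V)) x)
          else fun u : (thetaIndex X).Fibre ((thetaIndex X).over (.inr v : (thetaIndex X).V)) => (1 : Carrier u.1)) ≠
      unitEmbed X logv stripAutDH (ismDH logv) refl_mem_stripAutDH (refl_mem_ismDH logv) (Setting.labelSucc i) (.inr v) y' := by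
  classical
  -- a functional killing `(1,…,1)` and not `x·e_v`, and one normalised at `1 ∈ K_v`
  haveI : Module.Projective ℚ ((logShellsDH X logv).Packet1 ((thetaIndex X).over (.inr v : (thetaIndex X).V)) ⧸
      Submodule.span ℚ {(fun u : (thetaIndex X).Fibre ((thetaIndex X).over (.inr v : (thetaIndex X).V)) => (1 : Carrier u.1) :
          (logShellsDH X logv).Packet1 ((thetaIndex X).over (.inr v : (thetaIndex X).V)))}) := Module.Projective.of_free
  obtain ⟨lam0, hlamx, hlam1⟩ := Submodule.exists_dual_map_eq_bot_of_notMem hx inferInstance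
  have hlamone : lam0 (fun u : (thetaIndex X).Fibre ((thetaIndex X).over (.inr v : (thetaIndex X).V)) => (1 : Carrier u.1)) = 0 := by
    have hmem : lam0 (fun u : (thetaIndex X).Fibre ((thetaIndex X).over (.inr v : (thetaIndex X).V)) => (1 : Carrier u.1)) ∈
        (Submodule.span ℚ {(fun u : (thetaIndex X).Fibre ((thetaIndex X).over (.inr v : (thetaIndex X).V)) => (1 : Carrier u.1) :
          (logShellsDH X logv).Packet1 ((thetaIndex X).over (.inr v : (thetaIndex X).V)))}).map lam0 :=
      Submodule.mem_map_of_mem (Submodule.mem_span_singleton_self _)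
    rw [hlam1] at hmem
    exact (Submodule.mem_bot ℚ).1 hmem
  obtain ⟨εv, hεv⟩ := Module.Projective.exists_dual_eq_one ℚ (one_ne_zero (α := Carrier (.inr v : (thetaIndex X).V)))
  let prv : (logShellsDH X logv).Packet1 ((thetaIndex X).over (.inr v : (thetaIndex X).V)) →ₗ[ℚ] Carrier (.inr v : (thetaIndex X).V) :=
    LinearMap.proj ((thetaIndex X).toFibre (.inr v : (thetaIndex X).V))
  let φ : (thetaIndex X).Caps (Setting.labelSucc i) →
      ((logShellsDH X logv).Packet1 ((thetaIndex X).over (.inr v : (thetaIndex X).V)) →ₗ[ℚ] ℚ) := fun a =>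
    if a = 0 then lam0 else εv ∘ₗ prv
  let Mφ : (logShellsDH X logv).Packet (Setting.labelSucc i) ((thetaIndex X).over (.inr v : (thetaIndex X).V)) →ₗ[ℚ] ℚ :=
    PiTensorProduct.lift ((MultilinearMap.mkPiAlgebra ℚ ((thetaIndex X).Caps (Setting.labelSucc i)) ℚ).compLinearMap φ)
  have hMφ : ∀ f : (thetaIndex X).Caps (Setting.labelSucc i) →
      (logShellsDH X logv).Packet1 ((thetaIndex X).over (.inr v : (thetaIndex X).V)),
      Mφ ((logShellsDH X logv).tprod (Setting.labelSucc i) _ f) = ∏ a, φ a (f a) := fun f => by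
    show PiTensorProduct.lift _ (PiTensorProduct.tprod ℚ f) = _
    rw [PiTensorProduct.lift.tprod, MultilinearMap.compLinearMap_apply, MultilinearMap.mkPiAlgebra_apply]
  have h0last : (0 : (thetaIndex X).Caps (Setting.labelSucc i)) ≠ (thetaIndex X).selfIndex (Setting.labelSucc i) := by
    intro h
    have := congrArg Fin.val h
    simp [ThetaIndex.selfIndex, Setting.labelSucc] at this
  have hφ0 : φ 0 = lam0 := if_pos rfl
  have hφne : ∀ a, a ≠ 0 → φ a = εv ∘ₗ prv := fun a ha0 => if_neg ha0
  intro heq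
  have h1 := congrArg Mφ heq
  -- the unit embedding side vanishes (factor `0` is `(1,…,1)`)
  have hR : Mφ (unitEmbed X logv stripAutDH (ismDH logv) refl_mem_stripAutDH (refl_mem_ismDH logv) (Setting.labelSucc i) (.inr v) y') =
      0 := by
    show Mφ ((logShellsDH X logv).tprod (Setting.labelSucc i) _
      (unitFamily X logv stripAutDH (ismDH logv) refl_mem_stripAutDH (refl_mem_ismDH logv) (Setting.labelSucc i) (.inr v) y')) = 0
    rw [hMφ]
    refine Finset.prod_eq_zero (Finset.mem_univ (0 : (thetaIndex X).Caps (Setting.labelSucc i))) ?_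
    rw [hφ0, show unitFamily X logv stripAutDH (ismDH logv) refl_mem_stripAutDH (refl_mem_ismDH logv) (Setting.labelSucc i) (.inr v) y' 0 =
      fun u : (thetaIndex X).Fibre ((thetaIndex X).over (.inr v : (thetaIndex X).V)) => (1 : Carrier u.1) from if_neg h0last]
    exact hlamone
  rw [hMφ, hR] at h1
  -- the swapped side does not
  refine absurd h1 (Finset.prod_ne_zero_iff.mpr fun a _ => ?_)
  by_cases ha0 : a = 0
  · subst ha0
    rw [hφ0, if_pos rfl]
    exact hlamx
  · rw [hφne a ha0, if_neg ha0, LinearMap.comp_apply]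
    show εv (1 : Carrier (.inr v : (thetaIndex X).V)) ≠ 0
    rw [hεv]
    exact one_ne_zero

/-! ## 2. The (Ind1) capsule transposition `(0 j)` moves the honest splitting monoid when a theta value is irrational -/

open scoped Classical in
/-- **THE HONEST LGP SPLITTING MONOID IS STAR-MOVING under (Ind1)** when ONE theta value `ζ_{j₀}·qroot^{j₀²}` (`j₀ ∈ 𝔽_l^⋇`) is IRRATIONAL in
`K_v` (binder `hirr`: no rational multiple of `1` equals it): the (Ind1)-family of capsule transpositions `(0 ↔ j)` at every label (Dupuy–Hilado
§4.7, `Real.mem_Ind1_logShellsDH_iff`) carries abc-iut-c312-5's `Real.splittingMonoidLGP X logv … v qroot ζ` to a DIFFERENT set — the image of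
the value profile has `j₀`-component `(ξ_{j₀}·e_v) ⊗ 1 ⊗ ⋯ ⊗ 1`, which is no unit embedding (§1). In print's situation `hirr` holds at every
label: the Tate parameter of a curve with algebraic `j`-invariant is transcendental (Barré-Sirieix–Diaz–Gramain–Philibert 1996; NOT typed here).
[claim: Mochizuki2012, status: disputed] [cite: DupuyHilado2025, §4.7] -/
theorem exists_ind1Family_moves_splittingMonoidLGP_of_irrational (v : HeightOneSpectrum (𝓞 F)) (qroot : Carrier (.inr v : (thetaIndex X).V))
    (ζ : (thetaIndex X).LabelStar → (Carrier (.inr v : (thetaIndex X).V))ˣ) (j₀ : (thetaIndex X).LabelStar)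
    (hirr : ∀ c : ℚ, c • (1 : Carrier (.inr v : (thetaIndex X).V)) ≠ (ζ j₀ : Carrier (.inr v : (thetaIndex X).V)) * qroot ^ ((j₀.1 : ℕ) ^ 2)) :
    ∃ Φ ∈ (logShellsDH X logv).Ind1Family,
      (logShellsDH X logv).starAut Φ (.inr v) ''
          splittingMonoidLGP X logv stripAutDH (ismDH logv) refl_mem_stripAutDH (refl_mem_ismDH logv) v qroot ζ ≠
        splittingMonoidLGP X logv stripAutDH (ismDH logv) refl_mem_stripAutDH (refl_mem_ismDH logv) v qroot ζ := by
  classical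
  -- the capsule transposition `(0 ↔ last)` at every label, shared by all `v_ℚ`
  let Φ : (logShellsDH X logv).PacketAut := fun j vQ =>
    (logShellsDH X logv).permute j vQ (Equiv.swap 0 ((thetaIndex X).selfIndex j))
  have hΦ : Φ ∈ (logShellsDH X logv).Ind1Family := fun j =>
    (mem_Ind1_logShellsDH_iff X logv j _).2 ⟨Equiv.swap 0 ((thetaIndex X).selfIndex j), fun _ => rfl⟩
  refine ⟨Φ, hΦ, fun himg => ?_⟩
  -- the star label `j₀ = i₀ + 1`
  obtain ⟨j, hjne⟩ := j₀
  obtain ⟨i₀, rfl⟩ : ∃ i₀ : Fin (thetaIndex X).lstar, Setting.labelSucc i₀ = j := ⟨j.pred hjne, Fin.succ_pred _ _⟩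
  have hmem := valueProfile_mem_splittingMonoidLGP X logv stripAutDH (ismDH logv) refl_mem_stripAutDH (refl_mem_ismDH logv) v qroot ζ
  have himg_mem : (logShellsDH X logv).starAut Φ (.inr v)
      (tupleEmbed X logv stripAutDH (ismDH logv) refl_mem_stripAutDH (refl_mem_ismDH logv) (.inr v)
        (valueProfileOf qroot (fun j : (thetaIndex X).LabelStar => (j.1 : ℕ) ^ 2) ζ)) ∈
      splittingMonoidLGP X logv stripAutDH (ismDH logv) refl_mem_stripAutDH (refl_mem_ismDH logv) v qroot ζ := by
    rw [← himg]; exact Set.mem_image_of_mem _ hmem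
  obtain ⟨x', -, hx'⟩ := himg_mem
  have hj := congrFun hx' ⟨Setting.labelSucc i₀, hjne⟩
  -- `ξ_{j₀}·e_v` is not a rational multiple of `(1,…,1)`
  have hx : (Pi.single (M := fun u : (thetaIndex X).Fibre ((thetaIndex X).over (.inr v : (thetaIndex X).V)) => Carrier u.1)
        ((thetaIndex X).toFibre (.inr v : (thetaIndex X).V))
        (valueProfileOf qroot (fun j : (thetaIndex X).LabelStar => (j.1 : ℕ) ^ 2) ζ ⟨Setting.labelSucc i₀, hjne⟩) :
          (logShellsDH X logv).Packet1 ((thetaIndex X).over (.inr v : (thetaIndex X).V))) ∉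
      Submodule.span ℚ {(fun u : (thetaIndex X).Fibre ((thetaIndex X).over (.inr v : (thetaIndex X).V)) => (1 : Carrier u.1) :
          (logShellsDH X logv).Packet1 ((thetaIndex X).over (.inr v : (thetaIndex X).V)))} := by
    intro hmemspan
    obtain ⟨c, hc⟩ := Submodule.mem_span_singleton.1 hmemspan
    have hcv := congrFun hc ((thetaIndex X).toFibre (.inr v : (thetaIndex X).V))
    rw [Pi.single_eq_same, valueProfileOf_apply] at hcv
    exact hirr c hcv
  refine tprod_swap_ne_unitEmbed X logv v i₀ _ hx (x' ⟨Setting.labelSucc i₀, hjne⟩) ?_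
  -- the `j₀`-th component of the image IS the swapped pure tensor
  rw [show unitEmbed X logv stripAutDH (ismDH logv) refl_mem_stripAutDH (refl_mem_ismDH logv) (Setting.labelSucc i₀) (.inr v) (x' ⟨Setting.labelSucc i₀, hjne⟩) =
      ((logShellsDH X logv).starAut Φ (.inr v)
        (tupleEmbed X logv stripAutDH (ismDH logv) refl_mem_stripAutDH (refl_mem_ismDH logv) (.inr v)
          (valueProfileOf qroot (fun j : (thetaIndex X).LabelStar => (j.1 : ℕ) ^ 2) ζ))) ⟨Setting.labelSucc i₀, hjne⟩ from hj]
  show _ = (logShellsDH X logv).permute (Setting.labelSucc i₀) _ (Equiv.swap 0 ((thetaIndex X).selfIndex (Setting.labelSucc i₀)))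
      ((logShellsDH X logv).tprod (Setting.labelSucc i₀) _
        (unitFamily X logv stripAutDH (ismDH logv) refl_mem_stripAutDH (refl_mem_ismDH logv) (Setting.labelSucc i₀) (.inr v)
          (valueProfileOf qroot (fun j : (thetaIndex X).LabelStar => (j.1 : ℕ) ^ 2) ζ ⟨Setting.labelSucc i₀, hjne⟩)))
  rw [LogShells.permute_tprod, Equiv.symm_swap]
  congr 1
  funext a
  have h0last : (0 : (thetaIndex X).Caps (Setting.labelSucc i₀)) ≠ (thetaIndex X).selfIndex (Setting.labelSucc i₀) := by
    intro h
    have := congrArg Fin.val h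
    simp [ThetaIndex.selfIndex, Setting.labelSucc] at this
  by_cases ha0 : a = 0
  · subst ha0
    rw [if_pos rfl, Equiv.swap_apply_left, unitFamily_self]
    rfl
  · rw [if_neg ha0]
    by_cases hal : a = (thetaIndex X).selfIndex (Setting.labelSucc i₀)
    · subst hal
      rw [Equiv.swap_apply_right]
      exact (if_neg h0last : unitFamily X logv stripAutDH (ismDH logv) refl_mem_stripAutDH (refl_mem_ismDH logv)
        (Setting.labelSucc i₀) (.inr v) _ 0 = _).symm
    · rw [Equiv.swap_apply_of_ne_of_ne ha0 hal]
      exact (if_neg hal : unitFamily X logv stripAutDH (ismDH logv) refl_mem_stripAutDH (refl_mem_ismDH logv)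
        (Setting.labelSucc i₀) (.inr v) _ a = _).symm

/-- **Hence every Θ-datum family whose value at the bad place `v` is the honest LGP splitting monoid with an irrational theta value is
STAR-MOVING** (the right horn of `ObstructionSS38.exists_imagePinned_residual_iff_settingPrVolSharp`; the single-place complement of
`ObstructionSS44.not_insulated_of_eq_splittingMonoidLGP`). [claim: Mochizuki2012, status: disputed] -/
theorem not_insulated_of_eq_splittingMonoidLGP_of_irrational (v : HeightOneSpectrum (𝓞 F))
    (hv : (.inr v : (thetaIndex X).V) ∈ (thetaIndex X).Vbad) (qroot : Carrier (.inr v : (thetaIndex X).V))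
    (ζ : (thetaIndex X).LabelStar → (Carrier (.inr v : (thetaIndex X).V))ˣ) (j₀ : (thetaIndex X).LabelStar)
    (hirr : ∀ c : ℚ, c • (1 : Carrier (.inr v : (thetaIndex X).V)) ≠ (ζ j₀ : Carrier (.inr v : (thetaIndex X).V)) * qroot ^ ((j₀.1 : ℕ) ^ 2))
    (Ψ₀ : ∀ v' : (thetaIndex X).V, v' ∈ (thetaIndex X).Vbad → Set ((logShellsDH X logv).StarPacket v'))
    (hΨ₀ : Ψ₀ (.inr v) hv = splittingMonoidLGP X logv stripAutDH (ismDH logv) refl_mem_stripAutDH (refl_mem_ismDH logv) v qroot ζ) :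
    ¬ ∀ Φ ∈ Subgroup.closure ((logShellsDH X logv).Ind1Family ∪ (logShellsDH X logv).Ind2Family),
        ∀ (v' : (thetaIndex X).V) (hv' : v' ∈ (thetaIndex X).Vbad), (logShellsDH X logv).starAut Φ v' '' Ψ₀ v' hv' = Ψ₀ v' hv' := by
  obtain ⟨Φ, hΦ, hne⟩ := exists_ind1Family_moves_splittingMonoidLGP_of_irrational X logv v qroot ζ j₀ hirr
  intro hins
  apply hne
  rw [← hΨ₀]
  exact hins Φ (Subgroup.subset_closure (Or.inl hΦ)) (.inr v) hv

end Summit.ABC.IUTFork.Repair.ObstructionSS46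

end
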